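import Summits.CriticalPhenomena.PercolationContinuityZ3.Theorems.PercNearOneGluingNoHeavyLowerTailFloorSplitOneLayerStars
import Summits.CriticalPhenomena.PercolationContinuityZ3.Theorems.PercNearOneGluingNoHeavyLowerTailFloorSplitStarRows
import HarnessLib

/-!
# `NoHeavyLowerTail` (stmt-CriticalPhenomena-4575) — one-layer observers: the star sums

Helper file of lemma factory #5 (`prim-lf-5`, gen 10; memo `run/shared/lean/prim/prim-lf-5/FSCIL-ONELAYER-PROOF.md`,
(L0) and Step 2).  `--supports stmt-CriticalPhenomena-4575`.  No definitions, no named facts, no sorries.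

For a one-layer observer `o` of the relay set `A` (`w s(o,u) = 0` off `A`), level `j`, star `B ⊆ A` with event
`σ_B`, and the `H = G ∖ {o}` events (`↔` below is `↔ off o`, `openConnIn {o}ᶜ`)
`E^small_v = {|{x ∈ A : v ↔ x}| ≤ j}`, `E^U_B = {|{x ∈ A : B ↔ x}| ≤ j}`, `E^conn_{v,B} = {v ↔ B}`, `E^nc_{v,B} = {v ↮ B}`:
* `real_light_inter_starEvent_of_mem` / `_of_not_mem`: `μ(N_v ≤ j, σ_B) = μ(σ_B)·μ(E^U_B)` if `v ∈ B`, and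
  `= μ(σ_B)·(μ(E^small_v ∩ E^nc_{v,B}) + μ(E^U_B ∩ E^conn_{v,B}))` if `v ∉ B`;
  `real_bad_inter_starEvent`: `μ(1 ≤ N ≤ j, σ_B) = μ(σ_B)·μ(E^U_B)` (`B ≠ ∅`), `= 0` (`B = ∅`);
  summed over the stars (`KNPreFKG.real_eq_sum_inter_starEvent`): `real_light_eq_sum`, `real_bad_eq_sum`;
* the `H`-side bookkeeping `E^U_{{a}} = E^small_a`, the `|B| ≤ 1` values, `E^U_B ⊆ E^small_b` (`b ∈ B`);
* the pull-back forms of the four events (used by the final file to read the star rows of `FloorSplitStarRows`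
  on `G ∖ {o}` through the restriction coupling).
-/

noncomputable section

namespace Summit.CriticalPhenomena.PercolationContinuityZ3.Theorems

open MeasureTheory Set Literature.Probability.LatticeModels Literature.Probability.Percolation
open Literature.Probability.Percolation.KNPreFKG
open scoped Classical

variable {V : Type*} [Fintype V]

namespace FloorSplitOneLayer

/-! ### Pull-back forms of the four `H`-events -/

omit [Fintype V] in
/-- `E^small_v` is a pull-back along the restriction to `{o}ᶜ`. [this work] -/
theorem small_eq_preimage (A : Finset V) {o : V} (j : ℕ) {v : V} (hv : v ≠ o) :
    {ω : BondConfig V | (A.filter fun x => ω ∈ openConnIn {o}ᶜ v x).card ≤ j} =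
      restrictConfig (Subtype.val : ({o}ᶜ : Set V) → V) ⁻¹'
        {ω' | (A.filter fun x => ∃ hx : x ∈ ({o}ᶜ : Set V),
          (⟨x, hx⟩ : ({o}ᶜ : Set V)) ∈ openCluster ω' ⟨v, mem_compl_singleton_iff.2 hv⟩).card ≤ j} := by
  ext ω
  rw [mem_preimage, mem_setOf_eq, mem_setOf_eq, filter_openCluster_restrict_eq]

omit [Fintype V] in
/-- `E^U_B` is a pull-back along the restriction to `{o}ᶜ`. [this work] -/
theorem usmall_eq_preimage (A : Finset V) {o : V} (j : ℕ) {B : Finset V} (hB : ∀ u ∈ B, u ≠ o) :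
    {ω : BondConfig V | (A.filter fun x => ∃ u ∈ B, ω ∈ openConnIn {o}ᶜ u x).card ≤ j} =
      restrictConfig (Subtype.val : ({o}ᶜ : Set V) → V) ⁻¹'
        {ω' | (A.filter fun x => ∃ hx : x ∈ ({o}ᶜ : Set V),
          (⟨x, hx⟩ : ({o}ᶜ : Set V)) ∈ ⋃ u ∈ {u : ({o}ᶜ : Set V) | (u : V) ∈ B}, openCluster ω' u).card ≤ j} := by
  ext ω
  rw [mem_preimage, mem_setOf_eq, mem_setOf_eq, filter_iUnion_openCluster_restrict_eq A hB]

omit [Fintype V] in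
/-- `E^conn_{v,B}` is a pull-back along the restriction to `{o}ᶜ`. [this work] -/
theorem conn_eq_preimage {o : V} {B : Finset V} (hB : ∀ u ∈ B, u ≠ o) {v : V} (hv : v ≠ o) :
    {ω : BondConfig V | ∃ u ∈ B, ω ∈ openConnIn {o}ᶜ v u} =
      restrictConfig (Subtype.val : ({o}ᶜ : Set V) → V) ⁻¹'
        {ω' | ∃ u ∈ {u : ({o}ᶜ : Set V) | (u : V) ∈ B},
          (openGraph ω').Reachable ⟨v, mem_compl_singleton_iff.2 hv⟩ u} := by
  ext ω
  rw [mem_preimage, mem_setOf_eq, mem_setOf_eq, exists_reachable_restrict_iff hB]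

omit [Fintype V] in
/-- `E^nc_{v,B}` is a pull-back along the restriction to `{o}ᶜ`. [this work] -/
theorem notConn_eq_preimage {o : V} {B : Finset V} (hB : ∀ u ∈ B, u ≠ o) {v : V} (hv : v ≠ o) :
    {ω : BondConfig V | ∀ u ∈ B, ω ∉ openConnIn {o}ᶜ v u} =
      restrictConfig (Subtype.val : ({o}ᶜ : Set V) → V) ⁻¹'
        {ω' | ∀ u ∈ {u : ({o}ᶜ : Set V) | (u : V) ∈ B},
          ¬ (openGraph ω').Reachable ⟨v, mem_compl_singleton_iff.2 hv⟩ u} := by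
  ext ω
  rw [mem_preimage, mem_setOf_eq, mem_setOf_eq]
  constructor
  · intro hω u hu hr
    exact hω (u : V) hu ((reachable_restrictConfig_val_iff _ ω ⟨v, mem_compl_singleton_iff.2 hv⟩ u).1 hr)
  · intro hω u hu hr
    have hu' : u ∈ ({o}ᶜ : Set V) := mem_compl_singleton_iff.2 (hB u hu)
    exact hω ⟨u, hu'⟩ hu
      ((reachable_restrictConfig_val_iff _ ω ⟨v, mem_compl_singleton_iff.2 hv⟩ ⟨u, hu'⟩).2 hr)

/-! ### The light events under a star -/

/-- **`v` glued to the star**: for `v ∈ B ⊆ A`, `μ(N_v ≤ j, σ_B) = μ(σ_B)·μ(E^U_B)`. [this work] -/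
theorem real_light_inter_starEvent_of_mem (w : Sym2 V → unitInterval) (A : Finset V) {o : V} (ho : o ∉ A)
    (j : ℕ) {B : Finset V} (hBA : B ⊆ A) {v : V} (hvB : v ∈ B) :
    (prodBernoulli w).real ({ω : BondConfig V | (A.filter fun x => ω ∈ openConn v x).card ≤ j} ∩
        starEvent o (↑B : Set V)) =
      (prodBernoulli w).real (starEvent o (↑B : Set V)) *
        (prodBernoulli w).real {ω : BondConfig V |
          (A.filter fun x => ∃ u ∈ B, ω ∈ openConnIn {o}ᶜ u x).card ≤ j} := by
  have hB : ∀ u ∈ B, u ≠ o := fun u hu h => ho (h ▸ hBA hu)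
  have hv : v ≠ o := hB v hvB
  have hset : {ω : BondConfig V | (A.filter fun x => ω ∈ openConn v x).card ≤ j} ∩ starEvent o (↑B : Set V) =
      {ω : BondConfig V | (A.filter fun x => ∃ u ∈ B, ω ∈ openConnIn {o}ᶜ u x).card ≤ j} ∩
        starEvent o (↑B : Set V) := by
    ext ω
    simp only [mem_inter_iff, mem_setOf_eq]
    constructor
    · rintro ⟨h, hσ⟩
      rw [filter_reachable_eq_union A ho hB hσ hv ⟨v, hvB, openConnIn_rfl (mem_compl_singleton_iff.2 hv) ω⟩]
        at h
      exact ⟨h, hσ⟩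
    · rintro ⟨h, hσ⟩
      rw [filter_reachable_eq_union A ho hB hσ hv ⟨v, hvB, openConnIn_rfl (mem_compl_singleton_iff.2 hv) ω⟩]
      exact ⟨h, hσ⟩
  rw [hset]
  exact real_inter_starEvent_of_eq_preimage w o _ (usmall_eq_preimage A j hB)

/-- **`v` read off the star**: for `v ∈ A`, `B ⊆ A` (of interest for `v ∉ B`; for `v ∈ B` the first event is empty),
`μ(N_v ≤ j, σ_B) = μ(σ_B)·(μ(E^small_v ∩ E^nc_{v,B}) + μ(E^U_B ∩ E^conn_{v,B}))`. [this work] -/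
theorem real_light_inter_starEvent_of_not_mem (w : Sym2 V → unitInterval) (A : Finset V) {o : V}
    (ho : o ∉ A) (j : ℕ) {B : Finset V} (hBA : B ⊆ A) {v : V} (hvA : v ∈ A) :
    (prodBernoulli w).real ({ω : BondConfig V | (A.filter fun x => ω ∈ openConn v x).card ≤ j} ∩
        starEvent o (↑B : Set V)) =
      (prodBernoulli w).real (starEvent o (↑B : Set V)) *
        ((prodBernoulli w).real ({ω : BondConfig V | (A.filter fun x => ω ∈ openConnIn {o}ᶜ v x).card ≤ j} ∩
            {ω | ∀ u ∈ B, ω ∉ openConnIn {o}ᶜ v u}) +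
          (prodBernoulli w).real ({ω : BondConfig V |
              (A.filter fun x => ∃ u ∈ B, ω ∈ openConnIn {o}ᶜ u x).card ≤ j} ∩
            {ω | ∃ u ∈ B, ω ∈ openConnIn {o}ᶜ v u})) := by
  set μ := prodBernoulli w with hμ
  have hB : ∀ u ∈ B, u ≠ o := fun u hu h => ho (h ▸ hBA hu)
  have hv : v ≠ o := fun h => ho (h ▸ hvA)
  set L : Set (BondConfig V) := {ω | (A.filter fun x => ω ∈ openConn v x).card ≤ j} with hL
  set Es : Set (BondConfig V) := {ω | (A.filter fun x => ω ∈ openConnIn {o}ᶜ v x).card ≤ j} with hEs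
  set EU : Set (BondConfig V) := {ω | (A.filter fun x => ∃ u ∈ B, ω ∈ openConnIn {o}ᶜ u x).card ≤ j} with hEU
  set Ec : Set (BondConfig V) := {ω | ∃ u ∈ B, ω ∈ openConnIn {o}ᶜ v u} with hEc
  set En : Set (BondConfig V) := {ω | ∀ u ∈ B, ω ∉ openConnIn {o}ᶜ v u} with hEn
  set σ : Set (BondConfig V) := starEvent o (↑B : Set V) with hσdef
  have hset : L ∩ σ = (Es ∩ En) ∩ σ ∪ (EU ∩ Ec) ∩ σ := by
    ext ω
    simp only [mem_inter_iff, mem_union, mem_setOf_eq, hL, hEs, hEU, hEc, hEn]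
    constructor
    · rintro ⟨h, hσ⟩
      by_cases hglue : ∃ u ∈ B, ω ∈ openConnIn {o}ᶜ v u
      · right
        rw [filter_reachable_eq_union A ho hB hσ hv hglue] at h
        exact ⟨⟨h, hglue⟩, hσ⟩
      · left
        push Not at hglue
        rw [filter_reachable_eq_cluster A ho hB hσ hv hglue] at h
        exact ⟨⟨h, hglue⟩, hσ⟩
    · rintro (⟨⟨h, hcut⟩, hσ⟩ | ⟨⟨h, hglue⟩, hσ⟩)
      · rw [filter_reachable_eq_cluster A ho hB hσ hv hcut]
        exact ⟨h, hσ⟩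
      · rw [filter_reachable_eq_union A ho hB hσ hv hglue]
        exact ⟨h, hσ⟩
  have hdisj : Disjoint ((Es ∩ En) ∩ σ) ((EU ∩ Ec) ∩ σ) := by
    rw [Set.disjoint_left]
    rintro ω ⟨⟨-, hcut⟩, -⟩ ⟨⟨-, ⟨u, huB, hvu⟩⟩, -⟩
    exact hcut u huB hvu
  have h1 : μ.real ((Es ∩ En) ∩ σ) = μ.real σ * μ.real (Es ∩ En) :=
    real_inter_starEvent_of_eq_preimage w o _ (by
      rw [hEs, hEn, small_eq_preimage A j hv, notConn_eq_preimage hB hv, ← preimage_inter])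
  have h2 : μ.real ((EU ∩ Ec) ∩ σ) = μ.real σ * μ.real (EU ∩ Ec) :=
    real_inter_starEvent_of_eq_preimage w o _ (by
      rw [hEU, hEc, usmall_eq_preimage A j hB, conn_eq_preimage hB hv, ← preimage_inter])
  rw [hset, measureReal_union hdisj MeasurableSet.of_discrete, h1, h2]
  ring

/-- **The bad event under a star**: `μ(1 ≤ N ≤ j, σ_B) = μ(σ_B)·μ(E^U_B)` for `∅ ≠ B ⊆ A` (under `σ_B` the
relays joined to `o` are `U(B) ⊇ B`). [this work] -/
theorem real_bad_inter_starEvent (w : Sym2 V → unitInterval) (A : Finset V) {o : V} (ho : o ∉ A) (j : ℕ)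
    {B : Finset V} (hBA : B ⊆ A) (hBne : B.Nonempty) :
    (prodBernoulli w).real ({ω : BondConfig V | 1 ≤ (A.filter fun x => ω ∈ openConn o x).card ∧
        (A.filter fun x => ω ∈ openConn o x).card ≤ j} ∩ starEvent o (↑B : Set V)) =
      (prodBernoulli w).real (starEvent o (↑B : Set V)) *
        (prodBernoulli w).real {ω : BondConfig V |
          (A.filter fun x => ∃ u ∈ B, ω ∈ openConnIn {o}ᶜ u x).card ≤ j} := by
  have hB : ∀ u ∈ B, u ≠ o := fun u hu h => ho (h ▸ hBA hu)
  obtain ⟨b, hb⟩ := hBne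
  have hset : {ω : BondConfig V | 1 ≤ (A.filter fun x => ω ∈ openConn o x).card ∧
        (A.filter fun x => ω ∈ openConn o x).card ≤ j} ∩ starEvent o (↑B : Set V) =
      {ω : BondConfig V | (A.filter fun x => ∃ u ∈ B, ω ∈ openConnIn {o}ᶜ u x).card ≤ j} ∩
        starEvent o (↑B : Set V) := by
    ext ω
    simp only [mem_inter_iff, mem_setOf_eq]
    constructor
    · rintro ⟨⟨-, h⟩, hσ⟩
      rw [filter_reachable_obs_eq A ho hB hσ] at h
      exact ⟨h, hσ⟩
    · rintro ⟨h, hσ⟩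
      rw [filter_reachable_obs_eq A ho hB hσ]
      refine ⟨⟨Finset.card_pos.2 ⟨b, mem_filter_union_of_mem A hB ω hb (hBA hb)⟩, h⟩, hσ⟩
  rw [hset]
  exact real_inter_starEvent_of_eq_preimage w o _ (usmall_eq_preimage A j hB)

omit [Fintype V] in
/-- Under `σ_∅` the observer is joined to no relay: `μ(1 ≤ N ≤ j, σ_∅) = 0`. [this work] -/
theorem real_bad_inter_starEvent_empty (w : Sym2 V → unitInterval) (A : Finset V) {o : V} (ho : o ∉ A)
    (j : ℕ) :
    (prodBernoulli w).real ({ω : BondConfig V | 1 ≤ (A.filter fun x => ω ∈ openConn o x).card ∧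
        (A.filter fun x => ω ∈ openConn o x).card ≤ j} ∩ starEvent o (↑(∅ : Finset V) : Set V)) = 0 := by
  have hset : {ω : BondConfig V | 1 ≤ (A.filter fun x => ω ∈ openConn o x).card ∧
      (A.filter fun x => ω ∈ openConn o x).card ≤ j} ∩ starEvent o (↑(∅ : Finset V) : Set V) = ∅ := by
    ext ω
    simp only [mem_inter_iff, mem_setOf_eq, mem_empty_iff_false, iff_false, not_and]
    rintro ⟨h1, -⟩ hσ
    obtain ⟨a, ha⟩ := Finset.card_pos.1 h1
    obtain ⟨haA, hoa⟩ := Finset.mem_filter.1 ha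
    rw [Finset.coe_empty] at hσ
    exact not_reachable_of_mem_starEvent_empty hσ (fun h => ho (h ▸ haA)) hoa
  rw [hset, measureReal_empty]

/-- **The bad probability as a star sum**: `μ(1 ≤ N ≤ j) = Σ_{∅ ≠ B ⊆ A} μ(σ_B)·μ(E^U_B)`. [this work] -/
theorem real_bad_eq_sum (w : Sym2 V → unitInterval) (A : Finset V) {o : V} (ho : o ∉ A)
    (hiso : ∀ u, u ≠ o → u ∉ A → w s(o, u) = 0) (j : ℕ) :
    (prodBernoulli w).real {ω : BondConfig V | 1 ≤ (A.filter fun x => ω ∈ openConn o x).card ∧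
        (A.filter fun x => ω ∈ openConn o x).card ≤ j} =
      ∑ B ∈ A.powerset.filter (fun B => B.Nonempty),
        (prodBernoulli w).real (starEvent o (↑B : Set V)) *
          (prodBernoulli w).real {ω : BondConfig V |
            (A.filter fun x => ∃ u ∈ B, ω ∈ openConnIn {o}ᶜ u x).card ≤ j} := by
  rw [real_eq_sum_inter_starEvent w A o ho hiso, Finset.sum_filter]
  refine Finset.sum_congr rfl fun B hB => ?_
  have hBA : B ⊆ A := Finset.mem_powerset.1 hB
  split_ifs with hne
  · exact real_bad_inter_starEvent w A ho j hBA hne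
  · rw [Finset.not_nonempty_iff_eq_empty] at hne
    subst hne
    exact real_bad_inter_starEvent_empty w A ho j

/-- **The lightness of a relay as a star sum**: for `v ∈ A`,
`μ(N_v ≤ j) = Σ_{B ⊆ A} μ(σ_B)·(μ(E^U_B) if v ∈ B, else μ(E^small_v ∩ E^nc_{v,B}) + μ(E^U_B ∩ E^conn_{v,B}))`.
[this work] -/
theorem real_light_eq_sum (w : Sym2 V → unitInterval) (A : Finset V) {o : V} (ho : o ∉ A)
    (hiso : ∀ u, u ≠ o → u ∉ A → w s(o, u) = 0) (j : ℕ) {v : V} (hvA : v ∈ A) :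
    (prodBernoulli w).real {ω : BondConfig V | (A.filter fun x => ω ∈ openConn v x).card ≤ j} =
      ∑ B ∈ A.powerset, (prodBernoulli w).real (starEvent o (↑B : Set V)) *
        (if v ∈ B then
          (prodBernoulli w).real {ω : BondConfig V |
            (A.filter fun x => ∃ u ∈ B, ω ∈ openConnIn {o}ᶜ u x).card ≤ j}
        else
          ((prodBernoulli w).real ({ω : BondConfig V |
              (A.filter fun x => ω ∈ openConnIn {o}ᶜ v x).card ≤ j} ∩ {ω | ∀ u ∈ B, ω ∉ openConnIn {o}ᶜ v u}) +
           (prodBernoulli w).real ({ω : BondConfig V |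
              (A.filter fun x => ∃ u ∈ B, ω ∈ openConnIn {o}ᶜ u x).card ≤ j} ∩
             {ω | ∃ u ∈ B, ω ∈ openConnIn {o}ᶜ v u}))) := by
  rw [real_eq_sum_inter_starEvent w A o ho hiso]
  refine Finset.sum_congr rfl fun B hB => ?_
  have hBA : B ⊆ A := Finset.mem_powerset.1 hB
  split_ifs with hvB
  · exact real_light_inter_starEvent_of_mem w A ho j hBA hvB
  · exact real_light_inter_starEvent_of_not_mem w A ho j hBA hvA

/-! ### `H`-side bookkeeping -/

omit [Fintype V] in
/-- `E^U_{{a}} = E^small_a`. [this work] -/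
theorem usmall_singleton_eq (A : Finset V) (o : V) (j : ℕ) (a : V) :
    {ω : BondConfig V | (A.filter fun x => ∃ u ∈ ({a} : Finset V), ω ∈ openConnIn {o}ᶜ u x).card ≤ j} =
      {ω | (A.filter fun x => ω ∈ openConnIn {o}ᶜ a x).card ≤ j} := by
  ext ω
  simp only [mem_setOf_eq, Finset.mem_singleton, exists_eq_left]

omit [Fintype V] in
/-- `E^U_B ⊆ E^small_b` for `b ∈ B`: `μ(E^U_B) ≤ μ(E^small_b)`. [this work] -/
theorem real_usmall_le_small (w : Sym2 V → unitInterval) (A : Finset V) (o : V) (j : ℕ) {B : Finset V}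
    {b : V} (hb : b ∈ B) :
    (prodBernoulli w).real {ω : BondConfig V |
        (A.filter fun x => ∃ u ∈ B, ω ∈ openConnIn {o}ᶜ u x).card ≤ j} ≤
      (prodBernoulli w).real {ω : BondConfig V | (A.filter fun x => ω ∈ openConnIn {o}ᶜ b x).card ≤ j} :=
  measureReal_mono fun ω hω =>
    le_trans (Finset.card_le_card (filter_cluster_subset_union A ω hb)) hω

omit [Fintype V] in
/-- The `B = ∅` value: `μ(E^small_v ∩ E^nc_{v,∅}) + μ(E^U_∅ ∩ E^conn_{v,∅}) = μ(E^small_v)`. [this work] -/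
theorem n_empty_eq (w : Sym2 V → unitInterval) (A : Finset V) (o : V) (j : ℕ) (v : V) :
    (prodBernoulli w).real ({ω : BondConfig V | (A.filter fun x => ω ∈ openConnIn {o}ᶜ v x).card ≤ j} ∩
        {ω | ∀ u ∈ (∅ : Finset V), ω ∉ openConnIn {o}ᶜ v u}) +
      (prodBernoulli w).real ({ω : BondConfig V |
          (A.filter fun x => ∃ u ∈ (∅ : Finset V), ω ∈ openConnIn {o}ᶜ u x).card ≤ j} ∩
        {ω | ∃ u ∈ (∅ : Finset V), ω ∈ openConnIn {o}ᶜ v u}) =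
      (prodBernoulli w).real {ω : BondConfig V | (A.filter fun x => ω ∈ openConnIn {o}ᶜ v x).card ≤ j} := by
  have h1 : {ω : BondConfig V | ∀ u ∈ (∅ : Finset V), ω ∉ openConnIn {o}ᶜ v u} = univ := by
    ext ω; simp
  have h2 : {ω : BondConfig V | ∃ u ∈ (∅ : Finset V), ω ∈ openConnIn {o}ᶜ v u} = ∅ := by
    ext ω; simp
  rw [h1, h2, inter_univ, inter_empty, measureReal_empty, add_zero]

/-- The `B = {b}`, `v ↔/↮ b` value: `μ(E^small_v ∩ E^nc_{v,{b}}) + μ(E^U_{{b}} ∩ E^conn_{v,{b}}) = μ(E^small_v)`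
(if `v ↔ b` off `o`, the relays joined to `b` and to `v` coincide). [this work] -/
theorem n_singleton_eq (w : Sym2 V → unitInterval) (A : Finset V) (o : V) (j : ℕ) (v b : V) :
    (prodBernoulli w).real ({ω : BondConfig V | (A.filter fun x => ω ∈ openConnIn {o}ᶜ v x).card ≤ j} ∩
        {ω | ∀ u ∈ ({b} : Finset V), ω ∉ openConnIn {o}ᶜ v u}) +
      (prodBernoulli w).real ({ω : BondConfig V |
          (A.filter fun x => ∃ u ∈ ({b} : Finset V), ω ∈ openConnIn {o}ᶜ u x).card ≤ j} ∩
        {ω | ∃ u ∈ ({b} : Finset V), ω ∈ openConnIn {o}ᶜ v u}) =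
      (prodBernoulli w).real {ω : BondConfig V | (A.filter fun x => ω ∈ openConnIn {o}ᶜ v x).card ≤ j} := by
  set μ := prodBernoulli w with hμ
  set Es : Set (BondConfig V) := {ω | (A.filter fun x => ω ∈ openConnIn {o}ᶜ v x).card ≤ j} with hEs
  set C : Set (BondConfig V) := (openConnIn {o}ᶜ v b : Set (BondConfig V)) with hC
  have h1 : {ω : BondConfig V | ∀ u ∈ ({b} : Finset V), ω ∉ openConnIn {o}ᶜ v u} = Cᶜ := by
    ext ω; simp [hC]
  have h2 : {ω : BondConfig V | ∃ u ∈ ({b} : Finset V), ω ∈ openConnIn {o}ᶜ v u} = C := by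
    ext ω; simp [hC]
  have h3 : {ω : BondConfig V | (A.filter fun x => ∃ u ∈ ({b} : Finset V), ω ∈ openConnIn {o}ᶜ u x).card ≤ j} ∩ C =
      Es ∩ C := by
    rw [usmall_singleton_eq]
    ext ω
    simp only [mem_inter_iff, mem_setOf_eq, hEs, hC]
    constructor
    · rintro ⟨h, hc⟩
      rw [filter_cluster_eq_of_conn A hc]
      exact ⟨h, hc⟩
    · rintro ⟨h, hc⟩
      rw [filter_cluster_eq_of_conn A hc] at h
      exact ⟨h, hc⟩
  rw [h1, h2, h3, Set.inter_comm Es Cᶜ, Set.inter_comm Es C]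
  have := measureReal_inter_add_sdiff (μ := μ) (s := Es) (t := C) MeasurableSet.of_discrete
  rw [Set.sdiff_eq, Set.inter_comm Es C, Set.inter_comm Es Cᶜ] at this
  linarith

/-- The row quantity: `μ(E^U_B) + μ(E^small_v) − n_v(B) = μ(E^U_B ∩ E^nc_{v,B}) + μ(E^small_v ∩ E^conn_{v,B})`.
[this work] -/
theorem row_quantity_eq (w : Sym2 V → unitInterval) (A : Finset V) (o : V) (j : ℕ) (v : V) (B : Finset V) :
    (prodBernoulli w).real {ω : BondConfig V | (A.filter fun x => ∃ u ∈ B, ω ∈ openConnIn {o}ᶜ u x).card ≤ j} +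
      (prodBernoulli w).real {ω : BondConfig V | (A.filter fun x => ω ∈ openConnIn {o}ᶜ v x).card ≤ j} -
      ((prodBernoulli w).real ({ω : BondConfig V | (A.filter fun x => ω ∈ openConnIn {o}ᶜ v x).card ≤ j} ∩
          {ω | ∀ u ∈ B, ω ∉ openConnIn {o}ᶜ v u}) +
        (prodBernoulli w).real ({ω : BondConfig V |
            (A.filter fun x => ∃ u ∈ B, ω ∈ openConnIn {o}ᶜ u x).card ≤ j} ∩
          {ω | ∃ u ∈ B, ω ∈ openConnIn {o}ᶜ v u})) =
      (prodBernoulli w).real ({ω : BondConfig V |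
          (A.filter fun x => ∃ u ∈ B, ω ∈ openConnIn {o}ᶜ u x).card ≤ j} ∩
        {ω | ∀ u ∈ B, ω ∉ openConnIn {o}ᶜ v u}) +
      (prodBernoulli w).real ({ω : BondConfig V | (A.filter fun x => ω ∈ openConnIn {o}ᶜ v x).card ≤ j} ∩
        {ω | ∃ u ∈ B, ω ∈ openConnIn {o}ᶜ v u}) := by
  set μ := prodBernoulli w with hμ
  set Es : Set (BondConfig V) := {ω | (A.filter fun x => ω ∈ openConnIn {o}ᶜ v x).card ≤ j} with hEs
  set EU : Set (BondConfig V) := {ω | (A.filter fun x => ∃ u ∈ B, ω ∈ openConnIn {o}ᶜ u x).card ≤ j} with hEU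
  set C : Set (BondConfig V) := {ω | ∃ u ∈ B, ω ∈ openConnIn {o}ᶜ v u} with hC
  have hN : {ω : BondConfig V | ∀ u ∈ B, ω ∉ openConnIn {o}ᶜ v u} = Cᶜ := by
    ext ω; simp [hC]
  rw [hN]
  have e1 := measureReal_inter_add_sdiff (μ := μ) (s := Es) (t := C) MeasurableSet.of_discrete
  have e2 := measureReal_inter_add_sdiff (μ := μ) (s := EU) (t := C) MeasurableSet.of_discrete
  rw [Set.sdiff_eq] at e1 e2
  linarith

end FloorSplitOneLayer

end Summit.CriticalPhenomena.PercolationContinuityZ3.Theorems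

end
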